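import Summits.Ventures.HodgeRepro2.T5SU11IwasawaHaar
import Summits.Ventures.HodgeRepro2.T5SU11CoefficientL2

/-!
# The Haar measure of `SU(1,1)` in the order `g = k a_t n_s`, and Rühl's measure in Iwasawa
coordinates

`T5SU11IwasawaHaar` gives `dg = e^{-2t} ds dt dk` for `g = n_s a_t k`. Inverting
(`g⁻¹ = k⁻¹ a_{-t} n_{-s}`) and using that `ν`, `μ_K` and the Lebesgue measure of `ℂ = ℝ²` are
invariant under inversion / negation, the same measure in the order `g = k a_t n_s` is
`e^{2t} dk dt ds` (`lintegral_nu_kan`, `integral_nu_kan`, `integral_haar_kan`) — the classical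
`dg = e^{2ρ(log a)} dk da dn`. Specialised to Rühl's normalisation `μ_R = π⁻¹ ν` of
`T5SU11CoefficientL2`: `∫_G f dμ_R = π⁻¹ ∫_{ℝ²} e^{-2t} ∫_K f (n_s a_t k) dk ds dt`
(`integral_ruhl`) and `= π⁻¹ ∫_{ℝ²} e^{2t} ∫_K f (k a_t n_s) dk ds dt` (`integral_ruhl_kan`).
Nothing is claimed about (N).

Blind lane: Mathlib + the HodgeRepro2 prefix only; no sorry; axioms ⊆ {propext, Classical.choice,
Quot.sound}.
-/

namespace Summit.Ventures.HodgeRepro2.T5SU11IwasawaHaarKAN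

open MeasureTheory MeasureTheory.Measure Metric Filter Topology Set Complex
open T5UnitaryBound T5PoincareDensity T5PoincareInvariance T5PoincareMeasure T5SU11Unimodular
  T5SU11Fibration T5SU11FibrationHaar T5SU11Cartan T5SU11OneParameter T5BergmanCoefficient
  T5SU11HyperbolicSubgroup T5SU11UnipotentSubgroup T5SU11BorelSubgroup T5SU11Iwasawa
  T5SU11IwasawaUnique T5SU11BorelTransitive T5SU11IwasawaHaar T5HaarCircle T5SU11CoefficientL2
open scoped ENNReal NNReal Real

/-- `(n_s a_t k)⁻¹ = k⁻¹ a_{-t} n_{-s}`. -/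
lemma inv_unip_mul_hyp_mul_rot (s t : ℝ) (u : Circle) :
    (unip s * hyp t * rot u)⁻¹ = rot u⁻¹ * hyp (-t) * unip (-s) := by
  rw [map_inv, hyp_neg, unip_neg]
  group

section measure

variable [MeasurableSpace Circle] [BorelSpace Circle] (μC : Measure Circle) [IsHaarMeasure μC]

/-- **The Haar measure `ν` in the order `k a_t n_s` (`lintegral` form)**:
`∫_G F dν = ∫_ℂ e^{2 Im ζ} (∫_K F (k a_{Im ζ} n_{Re ζ}) dk) dζ` for every measurable `F`. -/
theorem lintegral_nu_kan (F : SU11 → ℝ≥0∞) (hF : Measurable F) :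
    ∫⁻ g, F g ∂(nu μC) =
      ∫⁻ ζ : ℂ, ENNReal.ofReal (Real.exp (2 * ζ.im)) *
        ∫⁻ u, F (rot u * hyp ζ.im * unip ζ.re) ∂μC := by
  haveI : IsInvInvariant (nu μC) := isInvInvariant (nu μC)
  rw [← lintegral_inv_eq_self F, lintegral_nu μC (fun g => F g⁻¹) (hF.comp measurable_inv),
    ← lintegral_neg_eq_self (fun ζ : ℂ => ENNReal.ofReal (Real.exp (2 * ζ.im)) *
      ∫⁻ u, F (rot u * hyp ζ.im * unip ζ.re) ∂μC)]
  refine lintegral_congr fun ζ => ?_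
  simp only [Complex.neg_im, Complex.neg_re]
  rw [← lintegral_inv_eq_self (fun u => F (rot u * hyp (-ζ.im) * unip (-ζ.re)))]
  congr 2
  · ring
  · funext u
    rw [inv_unip_mul_hyp_mul_rot]

/-- **The Haar measure `ν` in the order `k a_t n_s` (Bochner form)**: for `ν`-integrable `f`,
`∫_G f dν = ∫_ℂ e^{2 Im ζ} • (∫_K f (k a_{Im ζ} n_{Re ζ}) dk) dζ`. -/
theorem integral_nu_kan {E : Type*} [NormedAddCommGroup E] [NormedSpace ℝ E] [CompleteSpace E]
    (f : SU11 → E) (hf : Integrable f (nu μC)) :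
    ∫ g, f g ∂(nu μC) =
      ∫ ζ : ℂ, Real.exp (2 * ζ.im) • ∫ u, f (rot u * hyp ζ.im * unip ζ.re) ∂μC := by
  haveI : IsInvInvariant (nu μC) := isInvInvariant (nu μC)
  rw [← integral_inv_eq_self f (nu μC), integral_nu μC (fun g => f g⁻¹) hf.comp_inv,
    ← integral_neg_eq_self (fun ζ : ℂ => Real.exp (2 * ζ.im) •
      ∫ u, f (rot u * hyp ζ.im * unip ζ.re) ∂μC) volume]
  congr 1
  funext ζ
  simp only [Complex.neg_im, Complex.neg_re]
  rw [← integral_inv_eq_self (fun u => f (rot u * hyp (-ζ.im) * unip (-ζ.re))) μC]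
  congr 2
  · ring
  · funext u
    rw [inv_unip_mul_hyp_mul_rot]

/-- **The Haar measure of `SU(1,1)` in the order `k a_t n_s`**: for every Haar measure `μ` and every
`μ`-integrable `f`, with `c` the scalar of the fibration theorem,
`c • ∫_G f dμ = ∫_ℂ e^{2 Im ζ} • (∫_K f (k a_{Im ζ} n_{Re ζ}) dk) dζ` — i.e. `dg = e^{2t} dk dt ds`
for `g = k a_t n_s`. -/
theorem integral_haar_kan (μ : Measure SU11) [IsHaarMeasure μ] {E : Type*} [NormedAddCommGroup E]
    [NormedSpace ℝ E] [CompleteSpace E] (f : SU11 → E) (hf : Integrable f μ) :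
    (haarScalarFactor (nu μC) μ : ℝ) • ∫ g, f g ∂μ =
      ∫ ζ : ℂ, Real.exp (2 * ζ.im) • ∫ u, f (rot u * hyp ζ.im * unip ζ.re) ∂μC := by
  set c := haarScalarFactor (nu μC) μ with hc
  have hnu : nu μC = c • μ := nu_eq_smul μC μ
  have hint : Integrable f (nu μC) := by
    rw [hnu]
    exact hf.smul_measure ENNReal.coe_ne_top
  have h1 : ∫ g, f g ∂(nu μC) = (c : ℝ) • ∫ g, f g ∂μ := by
    rw [hnu, integral_smul_nnreal_measure, NNReal.smul_def]
  rw [← h1, integral_nu_kan μC f hint]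

/-! ### Rühl's measure `μ_R = π⁻¹ ν` in Iwasawa coordinates -/

omit [BorelSpace Circle] in
/-- `μ_R`-integrable functions are `ν`-integrable. -/
lemma integrable_nu_of_ruhl {E : Type*} [NormedAddCommGroup E] {f : SU11 → E}
    (hf : Integrable f ruhl) : Integrable f (nu haarCircle) := by
  unfold ruhl at hf
  have hc : ENNReal.ofReal π⁻¹ ≠ 0 := by positivity
  exact (integrable_smul_measure hc ENNReal.ofReal_ne_top).mp hf

/-- **Rühl's measure in Iwasawa coordinates `n_s a_t k`**:
`∫_G f dμ_R = π⁻¹ • ∫_ℂ e^{-2 Im ζ} • (∫_K f (n_{Re ζ} a_{Im ζ} k) dk) dζ`. -/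
theorem integral_ruhl {E : Type*} [NormedAddCommGroup E] [NormedSpace ℝ E] [CompleteSpace E]
    (f : SU11 → E) (hf : Integrable f ruhl) :
    ∫ g, f g ∂ruhl =
      π⁻¹ • ∫ ζ : ℂ, Real.exp (-(2 * ζ.im)) •
        ∫ u, f (unip ζ.re * hyp ζ.im * rot u) ∂haarCircle := by
  have hf' := integrable_nu_of_ruhl hf
  unfold ruhl
  rw [integral_smul_measure, ENNReal.toReal_ofReal (by positivity),
    integral_nu haarCircle f hf']

/-- **Rühl's measure in the order `k a_t n_s`**:
`∫_G f dμ_R = π⁻¹ • ∫_ℂ e^{2 Im ζ} • (∫_K f (k a_{Im ζ} n_{Re ζ}) dk) dζ`. -/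
theorem integral_ruhl_kan {E : Type*} [NormedAddCommGroup E] [NormedSpace ℝ E] [CompleteSpace E]
    (f : SU11 → E) (hf : Integrable f ruhl) :
    ∫ g, f g ∂ruhl =
      π⁻¹ • ∫ ζ : ℂ, Real.exp (2 * ζ.im) •
        ∫ u, f (rot u * hyp ζ.im * unip ζ.re) ∂haarCircle := by
  have hf' := integrable_nu_of_ruhl hf
  unfold ruhl
  rw [integral_smul_measure, ENNReal.toReal_ofReal (by positivity),
    integral_nu_kan haarCircle f hf']

end measure

end Summit.Ventures.HodgeRepro2.T5SU11IwasawaHaarKAN
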